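import Mathlib
import Literature.Analysis.Complex.DeBruijnUniversalFactors

/-!
# LINE L13 «DBR POLYNOMIAL DOOR» — node 3: half-plane domination `‖q^*(z)‖ ≤ ‖q(z)‖` on `ℂ₊`

Cell rh-split, route `DeBrangesSuzukiDoor`, item `stmt-RiemannHypothesis-21498` (`PolyDoorDomination`, registrar
rh-split-dbr-neg g16, skeleton `LineDbrB0.lean`).  If every root of a complex polynomial `q` lies in the closed
lower half-plane, then for `Im z > 0` the reflected polynomial `q^* := q.map conj` (so `q^*(z) = conj (q (conj z))`)
satisfies `‖q^*(z)‖ ≤ ‖q(z)‖`.  Proof: factor `q = c·∏(X − e)` over `ℂ` (algebraically closed), so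
`‖q^*(z)‖ = ‖q(conj z)‖ = ‖c‖·∏‖conj z − e‖` and `‖q(z)‖ = ‖c‖·∏‖z − e‖`, and factorwise
`‖conj z − e‖² − ‖z − e‖² = 4·(Im z)·(Im e) ≤ 0`.  Edge `q = 0`: both sides vanish.

Proved BY VALUE (the item's `payload.signature` verbatim; the route file does not yet declare the decl).
Classical (the Hermite–Biehler mechanism, Levin 1964 ch. VII); E-GENERAL, RH-free, Mathlib (+ the tree's `norm_multiset_prod`).
HONEST LABEL: known mathematics, RECORD line, 0 summit credit; nothing here bears on the truth of RH.
-/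

set_option linter.dupNamespace false

namespace Summit.RiemannHypothesis.RiemannHypothesis.Theorems.Splittings.PolyDoorDomination

open Polynomial
open Literature.Analysis.Complex.DeBruijn1950 (norm_multiset_prod)

/-- The factorwise inequality: for `Im z > 0 ≥ Im e`, `‖conj z − e‖ ≤ ‖z − e‖`
(`‖conj z − e‖² − ‖z − e‖² = 4 · Im z · Im e ≤ 0`). [folklore] -/
theorem norm_conj_sub_le {z e : ℂ} (hz : 0 < z.im) (he : e.im ≤ 0) :
    ‖(starRingEnd ℂ) z - e‖ ≤ ‖z - e‖ := by
  rw [← sq_le_sq₀ (norm_nonneg _) (norm_nonneg _), ← Complex.normSq_eq_norm_sq,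
    ← Complex.normSq_eq_norm_sq]
  simp only [Complex.normSq_apply, Complex.sub_re, Complex.conj_re, Complex.sub_im, Complex.conj_im]
  nlinarith [mul_nonpos_iff.2 (Or.inl ⟨hz.le, he⟩)]

/-- The reflected polynomial evaluated: `(q.map conj)(z) = conj (q (conj z))`. [folklore] -/
theorem eval_map_conj (q : ℂ[X]) (z : ℂ) :
    (q.map (starRingEnd ℂ)).eval z = (starRingEnd ℂ) (q.eval ((starRingEnd ℂ) z)) := by
  rw [Polynomial.eval_map, ← Polynomial.eval₂_hom, Complex.conj_conj]

/-- **Node 3 of LINE L13 (item `stmt-RiemannHypothesis-21498`, `PolyDoorDomination` by value).**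
If all roots of `q ∈ ℂ[X]` lie in the closed lower half-plane then `‖(q.map conj)(z)‖ ≤ ‖q(z)‖` for
`Im z > 0`. [folklore] (Hermite–Biehler mechanism; Levin, *Distribution of zeros of entire functions*, ch. VII.) -/
theorem polyDoorDomination :
    ∀ q : Polynomial ℂ, (∀ e ∈ q.roots, e.im ≤ 0) → ∀ z : ℂ, 0 < z.im →
      ‖(q.map (starRingEnd ℂ)).eval z‖ ≤ ‖q.eval z‖ := by
  intro q hq z hz
  rw [eval_map_conj, Complex.norm_conj]
  have hs : q.Splits := IsAlgClosed.splits q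
  rw [hs.eval_eq_prod_roots, hs.eval_eq_prod_roots, norm_mul, norm_mul, norm_multiset_prod,
    norm_multiset_prod, Multiset.map_map, Multiset.map_map]
  refine mul_le_mul_of_nonneg_left ?_ (norm_nonneg _)
  refine Multiset.prod_map_le_prod_map₀ _ _ (fun a _ => norm_nonneg _) (fun a ha => ?_)
  simpa only [Function.comp_apply] using norm_conj_sub_le hz (hq a ha)

end Summit.RiemannHypothesis.RiemannHypothesis.Theorems.Splittings.PolyDoorDomination
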